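import Summits.QuantumFields.YangMills.Theorems.ConvexGribovBodyBrascampLiebVacuumSCRankOneHelpers

/-!
# Stub `stub_rankOneCentral` of the line `SketchIdeator1` for the crux `BrascampLiebVacuumSC`
# (stmt-QuantumFields-16404, route `ConvexGribovBody`)

**Statement.** For a simply-connected compact simple `G` (`IsCompactSimpleLieGroup G`,
`SimplyConnectedSpace G`) and a faithful unitary `r : LatticeRep G` whose matrix Lie algebra
`𝔥 = repLieAlgebra r` has `dim_ℝ 𝔥 ≤ 3`, every involution `j` (`j² = 1`) is central. Classically:
`G ≅ SU(2)`, whose involutions are `±1`; the statement is false for `SO(3) = SU(2)/{±1}` (half-turns),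
which is excluded exactly by simple connectivity.

**Proof (no classification, no identification with `SU(2)`).**
1. (`RankOne.exists_adHom`) In an orthonormal frame `b₁, …, b_d` of `(𝔥, Re tr(X Yᴴ))`
   (`RankOne.exists_hsFrame`) the adjoint action `Ad_g X = ρ(g) X ρ(g)⁻¹` (which preserves `𝔥`, Hall
   Thm. 3.20 (1), and the Hilbert–Schmidt form, `ρ(g)` being unitary) has an orthogonal `d × d` matrix
   `M g`, multiplicative and continuous in `g`, of determinant `1` (`det = ±1`, `G` connected); padded
   by an identity block (`d ≤ 3`, `RankOne.exists_pad`) it is a continuous homomorphism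
   `Ad : G → SO(3)` (the tree's `SO3`).
2. (`RankOne.rotHom_apply_eq_one_of_mul_self_eq_one`, helpers file) A continuous homomorphism from a
   simply connected group to `SO(3)` kills involutions — path lifting through the universal cover
   `S³ → SO(3)` of `Literature/AlgebraicTopology/FundamentalGroup/RotationGroupSO3.lean`.
3. So `Ad j = 1`: `ρ(j)` commutes with `𝔥`, hence with `ρ(G)` (the exponential chart generates the
   connected `G`: `LiePerfect.commute_rho_of_commute_lieAlg` of the sister crux `CovarianceBound`), and
   `j ∈ Z(G)` by faithfulness of `ρ`.

No named facts are used.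
-/

set_option autoImplicit false

noncomputable section

open scoped BigOperators Topology Matrix
open Set Function
open Literature.MathematicalPhysics.QuantumFieldTheory Literature.MathematicalPhysics.QuantumLattice
open Literature.AlgebraicTopology.FundamentalGroup

namespace Summit.QuantumFields.YangMills.Theorems.BrascampLiebVacuumSC

namespace RankOne

/-! ### The adjoint representation in an orthonormal frame of `𝔥` -/

section Ad

variable {G : Type} [Group G] [TopologicalSpace G] (r : LatticeRep G) {d : ℕ}
  (b : Fin d → Matrix (Fin r.N) (Fin r.N) ℂ) (M : G → Matrix (Fin d) (Fin d) ℝ)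
  (hM : ∀ g i j, M g i j = hsForm r.N (b i) (r.ρ g * b j * r.ρ g⁻¹))

include hM

/-- **The matrix `M g = (⟨bᵢ, ρ(g) bⱼ ρ(g)⁻¹⟩)ᵢⱼ` of `Ad ρ(g)` in the frame `b` is continuous in `g`.**
[folklore] -/
theorem continuous_adMat [IsTopologicalGroup G] : Continuous M := by
  refine continuous_matrix fun i j => ?_
  simp only [hM, hsForm_apply]
  refine Complex.continuous_re.comp ?_
  refine (continuous_const.matrix_mul ?_).matrix_trace
  exact ((r.continuous.matrix_mul continuous_const).matrix_mul
    (r.continuous.comp continuous_inv)).matrix_conjTranspose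

variable (hbo : ∀ i j, hsForm r.N (b i) (b j) = if i = j then 1 else 0)

variable [CompactSpace G] (hbL : ∀ i, b i ∈ repLieAlgebra r)
  (hbe : ∀ X ∈ repLieAlgebra r, ∑ i, hsForm r.N (b i) X • b i = X)

include hbL hbe in
/-- `M` is multiplicative (`Ad` is a representation on `𝔥`, `Ad`-stable by Hall, Thm. 3.20 (1);
Parseval in the frame). [cite: Hall2015, Theorem 3.20 (1)] -/
theorem adMat_mul (g h : G) : M (g * h) = M g * M h := by
  ext i j
  have hY : r.ρ h * b j * r.ρ h⁻¹ ∈ repLieAlgebra r := conj_mem_repLieAlgebra r h (hbL j)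
  have hexp := hbe _ hY
  rw [Matrix.mul_apply, hM, mul_inv_rev, map_mul r.ρ, map_mul r.ρ]
  have : r.ρ g * r.ρ h * b j * (r.ρ h⁻¹ * r.ρ g⁻¹) =
      r.ρ g * (r.ρ h * b j * r.ρ h⁻¹) * r.ρ g⁻¹ := by simp only [mul_assoc]
  rw [this]
  conv_lhs => rw [← hexp]
  simp only [Finset.mul_sum, Finset.sum_mul, Matrix.mul_smul, Matrix.smul_mul, map_sum,
    map_smul, smul_eq_mul, hM]
  refine Finset.sum_congr rfl fun k _ => ?_
  ring

include hbo hbL hbe in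
/-- `M g` is orthogonal (`Ad`-invariance of the Hilbert–Schmidt form, Parseval). [cite: Sepanski2007, Thm. 5.18] -/
theorem adMat_transpose_mul_self (g : G) : (M g)ᵀ * M g = 1 := by
  ext i j
  have hYi : r.ρ g * b i * r.ρ g⁻¹ ∈ repLieAlgebra r := conj_mem_repLieAlgebra r g (hbL i)
  have hparse : hsForm r.N (r.ρ g * b i * r.ρ g⁻¹) (r.ρ g * b j * r.ρ g⁻¹) =
      ∑ k, M g k i * M g k j := by
    conv_lhs => rw [← hbe _ hYi]
    simp only [map_sum, map_smul, LinearMap.sum_apply, LinearMap.smul_apply, smul_eq_mul, hM]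
  rw [Matrix.mul_apply]
  simp only [Matrix.transpose_apply]
  rw [← hparse, hsForm_conj_rho, hbo, Matrix.one_apply]

include hbL hbe in
/-- If `M g = 1` then `Ad ρ(g)` is the identity on `𝔥`. [folklore] -/
theorem conj_eq_of_adMat_eq_one {g : G} (hg : M g = 1) {X : Matrix (Fin r.N) (Fin r.N) ℂ}
    (hX : X ∈ repLieAlgebra r) : r.ρ g * X * r.ρ g⁻¹ = X := by
  have hb : ∀ j, r.ρ g * b j * r.ρ g⁻¹ = b j := fun j => by
    have hYj : r.ρ g * b j * r.ρ g⁻¹ ∈ repLieAlgebra r := conj_mem_repLieAlgebra r g (hbL j)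
    conv_lhs => rw [← hbe _ hYj]
    have : ∀ k, hsForm r.N (b k) (r.ρ g * b j * r.ρ g⁻¹) = (1 : Matrix (Fin d) (Fin d) ℝ) k j :=
      fun k => by rw [← hg, hM]
    simp only [this, Matrix.one_apply, ite_smul, one_smul, zero_smul, Finset.sum_ite_eq',
      Finset.mem_univ, if_true]
  conv_lhs => rw [← hbe X hX]
  rw [Finset.mul_sum, Finset.sum_mul]
  conv_rhs => rw [← hbe X hX]
  refine Finset.sum_congr rfl fun k _ => ?_
  rw [Matrix.mul_smul, Matrix.smul_mul, hb]

include hbo hbL hbe in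
/-- `det (M g) = 1` on a connected group: `det = ±1` by orthogonality, continuous, `= 1` at `1`.
[folklore] -/
theorem det_adMat [IsTopologicalGroup G] [ConnectedSpace G] (g : G) : (M g).det = 1 := by
  have hsq : ∀ g, (M g).det * (M g).det = 1 := fun g => by
    have := congrArg Matrix.det (adMat_transpose_mul_self r b M hM hbo hbL hbe g)
    rwa [Matrix.det_mul, Matrix.det_transpose, Matrix.det_one] at this
  have hcont : Continuous fun g => (M g).det := (continuous_adMat r b M hM).matrix_det
  have hone : M 1 = 1 := by
    ext i j
    rw [hM, map_one, inv_one, map_one, one_mul, mul_one, hbo, Matrix.one_apply]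
  rcases mul_self_eq_one_iff.1 (hsq g) with h | h
  · exact h
  · exfalso
    have h1 : (M 1).det = 1 := by rw [hone, Matrix.det_one]
    have hmem : (0 : ℝ) ∈ Set.Icc ((fun g => (M g).det) g) ((fun g => (M g).det) 1) := by
      simp only [h, h1]
      norm_num
    obtain ⟨g₀, hg₀⟩ := intermediate_value_univ g 1 hcont hmem
    have hg₀' : (M g₀).det = 0 := hg₀
    have := hsq g₀
    rw [hg₀', mul_zero] at this
    exact zero_ne_one this

include hbo hbL hbe in
/-- **The adjoint homomorphism `Ad : G → SO(3)`** for `dim 𝔥 = d ≤ 3`: `g ↦ diag(M g, 1)` is a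
continuous homomorphism into the tree's `SO3`, and `Ad g = 1` forces `M g = 1`. [cite: Hall2015, Prop. 1.19 and §5.8] -/
theorem exists_adHom [IsTopologicalGroup G] [ConnectedSpace G] (hd : d ≤ 3) :
    ∃ A : G →* SO3, Continuous A ∧ ∀ g, A g = 1 → M g = 1 := by
  obtain ⟨P, hPc, hPi, hPt, hPd⟩ := exists_pad hd
  have hone : M 1 = 1 := by
    ext i j
    rw [hM, map_one, inv_one, map_one, one_mul, mul_one, hbo, Matrix.one_apply]
  have hmem : ∀ g, (P (M g))ᵀ * P (M g) = 1 ∧ (P (M g)).det = 1 := fun g =>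
    ⟨by rw [hPt, ← map_mul, adMat_transpose_mul_self r b M hM hbo hbL hbe, map_one],
      by rw [hPd, det_adMat r b M hM hbo hbL hbe]⟩
  refine ⟨{ toFun := fun g => ⟨P (M g), hmem g⟩, map_one' := ?_, map_mul' := ?_ }, ?_, ?_⟩
  · exact Subtype.ext (by
      show P (M 1) = 1
      rw [hone, map_one])
  · intro g h
    exact Subtype.ext (by
      show P (M (g * h)) = P (M g) * P (M h)
      rw [adMat_mul r b M hM hbL hbe, map_mul])
  · exact (hPc.comp (continuous_adMat r b M hM)).subtype_mk _
  · intro g hg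
    apply hPi
    rw [map_one]
    exact congrArg Subtype.val hg

end Ad

end RankOne

/-! ### The stub -/

open RankOne Summit.QuantumFields.YangMills.Cruxes.CovarianceBound.SupportWindow in
/-- **Stub `stub_rankOneCentral` (RESIDUAL F2′ — the rank-one case; the ONLY use of simple
connectivity).** For a simply-connected compact simple `G` whose matrix Lie algebra
`𝔥 = repLieAlgebra r` has real dimension `≤ 3`, every involution is central. Proof: in an
orthonormal frame of `(𝔥, Re tr(X Yᴴ))` the adjoint action `X ↦ ρ(g) X ρ(g)⁻¹` is a continuous
homomorphism `Ad : G → SO(dim 𝔥) ⊆ SO(3)` (padding by an identity block; `det = 1` by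
connectedness); by path lifting through the universal cover `S³ → SO(3)` (tree
`RotationGroupSO3.lean`), a continuous homomorphism from a SIMPLY CONNECTED group to `SO(3)` kills
involutions (`RankOne.rotHom_apply_eq_one_of_mul_self_eq_one`), so `Ad j = 1`: `ρ(j)` commutes with
`𝔥`, hence with `ρ(G)` (`exp 𝔥` generates the connected `G`, `LiePerfect.commute_rho_of_commute_lieAlg`),
and `j` is central by faithfulness. (Classically `G ≅ SU(2)` with involutions `±1`; `SO(3)`, where
half-turns are non-central involutions, is excluded exactly by `SimplyConnectedSpace`.)
[cite: HatcherAT2002, §1.3 and §3.D] [cite: Hall2015, Prop. 1.19 and §5.8] -/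
theorem stub_rankOneCentral :
    ∀ (G : Type) [Group G] [TopologicalSpace G] [IsTopologicalGroup G] [CompactSpace G],
      IsCompactSimpleLieGroup G → SimplyConnectedSpace G → ∀ (r : LatticeRep G),
        Module.finrank ℝ ↥(repLieAlgebra r) ≤ 3 → ∀ j : G, j * j = 1 → j ∈ Subgroup.center G := by
  intro G _ _ _ _ hG _ r hd j hj
  haveI : ConnectedSpace G := hG.1.1
  obtain ⟨b, hbL, hbo, hbe⟩ := exists_hsFrame (repLieAlgebra r)
  obtain ⟨A, hAc, hA1⟩ := exists_adHom r b
    (fun g => Matrix.of fun i j => hsForm r.N (b i) (r.ρ g * b j * r.ρ g⁻¹)) (fun _ _ _ => rfl)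
    hbo hbL hbe hd
  have hmat := hA1 j (rotHom_apply_eq_one_of_mul_self_eq_one A hAc hj)
  have hcomm : ∀ X ∈ r.lieAlgCarrier, Commute (r.ρ j) X := by
    intro X hX
    rw [LiePerfect.lieAlgCarrier_eq_coe] at hX
    have hfix := conj_eq_of_adMat_eq_one r b _ (fun _ _ _ => rfl) hbL hbe hmat hX
    calc r.ρ j * X = r.ρ j * X * r.ρ j⁻¹ * r.ρ j := by
          rw [mul_assoc (r.ρ j * X), ← map_mul, inv_mul_cancel, map_one, mul_one]
      _ = X * r.ρ j := by rw [hfix]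
  have hρ := LiePerfect.commute_rho_of_commute_lieAlg r hcomm
  rw [Subgroup.mem_center_iff]
  intro g
  apply r.injective
  rw [map_mul, map_mul]
  exact (hρ g).eq.symm

end Summit.QuantumFields.YangMills.Theorems.BrascampLiebVacuumSC

end
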